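import Summits.CriticalPhenomena.PercolationContinuityZ3.Theorems.PercNearOneGluingNoHeavyLowerTailKnQuestion8CoefficientwiseNoCoreAdjPoint
import Summits.CriticalPhenomena.PercolationContinuityZ3.Theorems.PercNearOneGluingNoHeavyLowerTailKnQuestion8CoefficientwisePendantEdge
import HarnessLib

/-!
# POINT-EDGE MONOTONICITY implies CONJECTURE NO-CORE for every point — prim-lf-2 gen 53 (part 7)

Support file (`--supports stmt-CriticalPhenomena-4575`, closed), prover `prim-lf-2` (gen 53).  No definitions, no named facts, no sorries; standard axioms.
Memo `prim-lf-2/CW-SERIES-gen53.md` §9.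

Setting.  Finite multigraph `ends : ι → Sym2 V`, root `x`; for an edge set `E ⊆ ι` the sub-multigraph `G[E]` has edge type `{j // j ∈ E}`; `K_E(s) = openCluster` of `x` in the
colouring `s ⊆ E` (red `s`, blue `E ∖ s`), and `NO-CORE_E(y)[1_u,g] := Σ_{s ⊆ E : ¬(y ∈ K_E s ∧ y ∈ K_E sᶜ)} ([u ∈ K_E s] − [u ∈ K_E sᶜ])·(g(K_E s) − g(K_E sᶜ))` (raw sum over the
`2^{|E|}` colourings; CONJECTURE NO-CORE, prim-lf-2 gen 46: `≥ 0` for monotone `g`).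
CONJECTURE PEM (POINT-EDGE MONOTONICITY, prim-lf-2 gen 53 §9): for an edge `e ∈ E` with ends `{u, p}`, `p ∉ {y, u}`:
`NO-CORE_{E∖e}(y)[1_u,g] ≤ NO-CORE_E(y)[1_u,g]`.  Exact census (code/gen53/c/pem.c, min over ALL monotone `g`): 0 exceptions on every graph with ≤ 6 vertices (856 800 `(G,e,u,y)` with
`p ∉ {x,y}`, 285 600 with `p = x`), and on LOBE(2,2)…(5,4), Petersen, Q3, K33, K34, K44, K5, K6, W7 (pemadv.c); 7 vertices and larger adversarial families running at hand-off
(prim-lf-2 kit j212474, j212486).  (For `p = x` the inequality is the root-edge route of part 6, `noCore_rootEdge_mono_of_sD2`.)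
* `noCore_point_eq_zero_of_isolated` — if no edge of `E` contains `u ≠ x` then `NO-CORE_E(y)[1_u,g] = 0`;
* `noCore_point_nonneg_of_pem` — **THEOREM: PEM (as a hypothesis, for the sub-multigraphs `G[E]` and the edges at `u`) implies `0 ≤ NO-CORE_E(y)[1_u,g]` for EVERY edge set `E`**
  (`u ≠ x`, `u ≠ y`, no loop at `u`, `g` monotone): strong induction on `E` — delete an edge at `u` whose other end is not `y` (PEM); when none is left, either `u` is isolated (`= 0`)
  or an edge joins `u` to `y` and gen 48's `noCore_adj_point_nonneg` ('NO-CORE at every neighbour of a point') applies.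
So the single monotonicity statement PEM carries the whole point case (`f = 1_u`) of CONJECTURE NO-CORE.
[cite: KozmaNitzan2024, Questions 8–9 (§5.5 p. 36) (context: the Question-8 pocket covariance programme)]
-/

namespace Summit.CriticalPhenomena.PercolationContinuityZ3.Theorems

open Finset Literature.Probability.Percolation

namespace Coefficientwise

variable {ι V : Type*} [Fintype ι] [DecidableEq ι] (ends : ι → Sym2 V) (x u y : V) (g : Set V → ℝ)

omit [Fintype ι] [DecidableEq ι] in
/-- A vertex `u ≠ x` met by no edge of `E` lies in no cluster of `x` of the sub-multigraph `G[E]`. [cite: KozmaNitzan2024, §5.5 (context only; folklore)] -/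
private theorem not_mem_cluster_of_isolated (E : Finset ι) (hux : u ≠ x) (hu : ∀ j ∈ E, u ∉ ends j)
    (s : Finset {j : ι // j ∈ E}) : u ∉ openCluster ((fun j : {j : ι // j ∈ E} => ends j.1) '' (↑s : Set {j : ι // j ∈ E})) x := by
  intro huK
  have hsub := openCluster_subset_of_adjClosed (fun j : {j : ι // j ∈ E} => ends j.1) x
    (↑s : Set {j : ι // j ∈ E}) {v : V | v ≠ u} (by simpa using hux.symm) (by
      intro a _ b hab
      rw [openGraph_image_adj] at hab
      obtain ⟨⟨i, _, hi⟩, _⟩ := hab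
      intro hb
      apply hu i.1 i.2
      rw [hi, hb]
      exact Sym2.mem_mk_right _ _)
  exact (hsub huK) rfl

omit [Fintype ι] in
open Classical in
/-- **An isolated point contributes nothing:** if `u ≠ x` is met by no edge of `E`, then `NO-CORE_E(y)[1_u,g] = 0`.
[cite: KozmaNitzan2024, Questions 8–9 (§5.5 p. 36) (context)] -/
theorem noCore_point_eq_zero_of_isolated (E : Finset ι) (hux : u ≠ x) (hu : ∀ j ∈ E, u ∉ ends j) :
    (∑ s ∈ (univ : Finset (Finset {j : ι // j ∈ E})).filter (fun s : Finset {j : ι // j ∈ E} => ¬ (y ∈ openCluster ((fun j : {j : ι // j ∈ E} => ends j.1) '' (↑s : Set {j : ι // j ∈ E})) x ∧ y ∈ openCluster ((fun j : {j : ι // j ∈ E} => ends j.1) '' (↑(sᶜ) : Set {j : ι // j ∈ E})) x)),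
      (((if u ∈ openCluster ((fun j : {j : ι // j ∈ E} => ends j.1) '' (↑s : Set {j : ι // j ∈ E})) x then (1 : ℝ) else 0) - (if u ∈ openCluster ((fun j : {j : ι // j ∈ E} => ends j.1) '' (↑(sᶜ) : Set {j : ι // j ∈ E})) x then (1 : ℝ) else 0)) *
        (g (openCluster ((fun j : {j : ι // j ∈ E} => ends j.1) '' (↑s : Set {j : ι // j ∈ E})) x) - g (openCluster ((fun j : {j : ι // j ∈ E} => ends j.1) '' (↑(sᶜ) : Set {j : ι // j ∈ E})) x)))) = 0 := by
  refine Finset.sum_eq_zero fun s _ => ?_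
  have h1 := not_mem_cluster_of_isolated ends x u E hux hu s
  have h2 := not_mem_cluster_of_isolated ends x u E hux hu sᶜ
  rw [if_neg h1, if_neg h2, sub_zero, zero_mul]

omit [Fintype ι] in
open Classical in
/-- **THEOREM (prim-lf-2 gen 53): POINT-EDGE MONOTONICITY implies CONJECTURE NO-CORE at every point.**  Let `u ≠ x`, `u ≠ y`, no loop at `u`, `g` monotone.  If for every edge set
`E`, every edge `e ∈ E` with ends `{u, p}`, `p ≠ y`, `p ≠ u`, one has `NO-CORE_{E.erase e}(y)[1_u,g] ≤ NO-CORE_E(y)[1_u,g]` (CONJECTURE PEM for the sub-multigraphs, at the point `u`),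
then `0 ≤ NO-CORE_E(y)[1_u,g]` for every edge set `E`.  [cite: KozmaNitzan2024, Questions 8–9 (§5.5 p. 36) (context)] -/
theorem noCore_point_nonneg_of_pem (hg : Monotone g) (hux : u ≠ x) (huy : u ≠ y) (hloop : ∀ j : ι, ends j ≠ s(u, u))
    (hPEM : ∀ (E : Finset ι) (e : ι) (p : V), e ∈ E → ends e = s(u, p) → p ≠ y → p ≠ u →
      (∑ s ∈ (univ : Finset (Finset {j : ι // j ∈ (E.erase e)})).filter (fun s : Finset {j : ι // j ∈ (E.erase e)} => ¬ (y ∈ openCluster ((fun j : {j : ι // j ∈ (E.erase e)} => ends j.1) '' (↑s : Set {j : ι // j ∈ (E.erase e)})) x ∧ y ∈ openCluster ((fun j : {j : ι // j ∈ (E.erase e)} => ends j.1) '' (↑(sᶜ) : Set {j : ι // j ∈ (E.erase e)})) x)),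
      (((if u ∈ openCluster ((fun j : {j : ι // j ∈ (E.erase e)} => ends j.1) '' (↑s : Set {j : ι // j ∈ (E.erase e)})) x then (1 : ℝ) else 0) - (if u ∈ openCluster ((fun j : {j : ι // j ∈ (E.erase e)} => ends j.1) '' (↑(sᶜ) : Set {j : ι // j ∈ (E.erase e)})) x then (1 : ℝ) else 0)) *
        (g (openCluster ((fun j : {j : ι // j ∈ (E.erase e)} => ends j.1) '' (↑s : Set {j : ι // j ∈ (E.erase e)})) x) - g (openCluster ((fun j : {j : ι // j ∈ (E.erase e)} => ends j.1) '' (↑(sᶜ) : Set {j : ι // j ∈ (E.erase e)})) x)))) ≤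
      (∑ s ∈ (univ : Finset (Finset {j : ι // j ∈ E})).filter (fun s : Finset {j : ι // j ∈ E} => ¬ (y ∈ openCluster ((fun j : {j : ι // j ∈ E} => ends j.1) '' (↑s : Set {j : ι // j ∈ E})) x ∧ y ∈ openCluster ((fun j : {j : ι // j ∈ E} => ends j.1) '' (↑(sᶜ) : Set {j : ι // j ∈ E})) x)),
      (((if u ∈ openCluster ((fun j : {j : ι // j ∈ E} => ends j.1) '' (↑s : Set {j : ι // j ∈ E})) x then (1 : ℝ) else 0) - (if u ∈ openCluster ((fun j : {j : ι // j ∈ E} => ends j.1) '' (↑(sᶜ) : Set {j : ι // j ∈ E})) x then (1 : ℝ) else 0)) *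
        (g (openCluster ((fun j : {j : ι // j ∈ E} => ends j.1) '' (↑s : Set {j : ι // j ∈ E})) x) - g (openCluster ((fun j : {j : ι // j ∈ E} => ends j.1) '' (↑(sᶜ) : Set {j : ι // j ∈ E})) x)))))
    (E : Finset ι) :
    0 ≤ (∑ s ∈ (univ : Finset (Finset {j : ι // j ∈ E})).filter (fun s : Finset {j : ι // j ∈ E} => ¬ (y ∈ openCluster ((fun j : {j : ι // j ∈ E} => ends j.1) '' (↑s : Set {j : ι // j ∈ E})) x ∧ y ∈ openCluster ((fun j : {j : ι // j ∈ E} => ends j.1) '' (↑(sᶜ) : Set {j : ι // j ∈ E})) x)),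
      (((if u ∈ openCluster ((fun j : {j : ι // j ∈ E} => ends j.1) '' (↑s : Set {j : ι // j ∈ E})) x then (1 : ℝ) else 0) - (if u ∈ openCluster ((fun j : {j : ι // j ∈ E} => ends j.1) '' (↑(sᶜ) : Set {j : ι // j ∈ E})) x then (1 : ℝ) else 0)) *
        (g (openCluster ((fun j : {j : ι // j ∈ E} => ends j.1) '' (↑s : Set {j : ι // j ∈ E})) x) - g (openCluster ((fun j : {j : ι // j ∈ E} => ends j.1) '' (↑(sᶜ) : Set {j : ι // j ∈ E})) x)))) := by
  induction E using Finset.strongInduction with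
  | H E ih =>
    by_cases h1 : ∃ e ∈ E, ∃ p : V, ends e = s(u, p) ∧ p ≠ y
    · obtain ⟨e, he, p, hep, hpy⟩ := h1
      have hpu : p ≠ u := by
        intro h; apply hloop e; rw [hep, h]
      exact le_trans (ih (E.erase e) (Finset.erase_ssubset he)) (hPEM E e p he hep hpy hpu)
    · push Not at h1
      by_cases h2 : ∃ e ∈ E, u ∈ ends e
      · -- every edge at `u` goes to `y`, and there is one: gen 48
        obtain ⟨e, he, hue⟩ := h2
        have hep : ends e = s(u, Sym2.Mem.other hue) := (Sym2.other_spec hue).symm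
        have hpy : Sym2.Mem.other hue = y := h1 e he _ hep
        rw [hpy] at hep
        have he' : (fun j : {j : ι // j ∈ E} => ends j.1) ⟨e, he⟩ = s(y, u) := by
          change ends e = s(y, u); rw [hep, Sym2.eq_swap]
        exact noCore_adj_point_nonneg (fun j : {j : ι // j ∈ E} => ends j.1) x y u he' huy g hg
      · push Not at h2
        exact le_of_eq (noCore_point_eq_zero_of_isolated ends x u y g E hux h2).symm

end Coefficientwise

end Summit.CriticalPhenomena.PercolationContinuityZ3.Theorems
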